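import Summits.ResolutionOfSingularities.ResolutionOfSingularities.Theses.ShadowGame
import Summits.ResolutionOfSingularities.ResolutionOfSingularities.Theses.FrobeniusClosing
import Summits.ResolutionOfSingularities.ResolutionOfSingularities.Theorems.FrobeniusClosingTorsorToLurelPerfectStubPerfectChartOfTemkin
import Summits.ResolutionOfSingularities.ResolutionOfSingularities.Theorems.FrobeniusClosingTorsorToLurelPerfectStubPerfectTowerClimb
import Literature.AlgebraicGeometry.Resolution.InseparableLocalUniformizationRelativeOneLeaf

/-!
# `TorsorToLurelPerfect` modulo Temkin's inseparable local uniformization theorem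

Crux `TorsorToLurelPerfect` (stmt-ResolutionOfSingularities-16162), shared verbatim by the routes
ShadowGame (primary decl) / FrobeniusClosing / WildCones / FoliationDescent / JacobianBudget /
EscapeRate (the six constants are one term; `torsorToLurelPerfect_frobeniusClosing_iff_shadowGame`
is `Iff.rfl`): for every prime `p`, local uniformization of `α_p`-torsors `t ^ p = a` over bases
regular at the centre over PERFECT ground fields of characteristic `p` implies RELATIVE local
uniformization over every perfect ground field of characteristic `p`.

Line `temkin-leaf` (`Cruxes/TorsorToLurelPerfect/Lines/temkin_leaf.lean`) proves it as Temkin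
2013 (J. Algebra 373 = arXiv:0804.1554v3), Thm. 1.3.2 + Rem. 1.3.5 (i)–(ii) at `[k : k^p] = 1`:
Temkin's theorem gives LU after a finite purely inseparable `L/K`; Frobenius `ρ = F^m` pushes the
uniformizing chart into `K` (a `k`-chart again because `k^{p^m} = k`) — the LANDED stub
`stub_perfectChartOfTemkin`; the `p`-radical tower `k(ρ N) ⊆ K` is climbed one `p`-th root at a
time by the crux's own hypothesis over the same perfect `k`, and the prescribed `R` is absorbed by
normality of the regular centre — the LANDED stub `stub_perfectTowerClimb`.

This file records what is UNCONDITIONAL already: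

* `torsorToLurelPerfect_of_temkin2013Relative` — **CONDITIONAL crux**: the named Literature fact
  `Temkin2013Relative` (Thm. 1.3.2, corrected relative form) implies the crux;
* `torsorToLurelPerfect_of_smoothFibre` — the same from the SINGLE remaining leaf of the tree's
  proof cone of Temkin's theorem, `Temkin2013RelativeCurveSmoothFibre` (Thm. 3.3.1 for `k`-smooth
  generic fibres), through the in-tree `Temkin2013Relative.of_smoothFibre`;
* the FrobeniusClosing copies and the `Iff.rfl` between the two route decls.

The item therefore rests on exactly one obligation, the same as `Valuative.TorsorToLurel` (10968),
`Valuative.TorsorToLurelFfinite` (0643), `Temkin2013` and `Temkin2013Relative`: the leaf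
`Temkin2013RelativeCurveSmoothFibre` (owned by the `Temkin2013` Literature unit; residual =
the algebraization (J2) of Thm. 3.3.1, Steps 2–4). The unconditional `TorsorToLurelPerfect_proof`
is appended here the moment `Temkin2013RelativeCurveSmoothFibre_holds` lands.
-/

noncomputable section

set_option linter.dupNamespace false -- mandated namespace of this single-conjunct summit

open IsLocalRing
open Literature.AlgebraicGeometry.Resolution

namespace Summit.ResolutionOfSingularities.ResolutionOfSingularities.Theorems

/-- The payload route's decl (FrobeniusClosing) and the item's primary decl (ShadowGame) are the
same proposition. [folklore] -/
theorem torsorToLurelPerfect_frobeniusClosing_iff_shadowGame :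
    Theses.FrobeniusClosing.TorsorToLurelPerfect ↔ Theses.ShadowGame.TorsorToLurelPerfect :=
  Iff.rfl

/-- **The crux modulo Temkin's theorem** (CONDITIONAL on the named Literature fact
`Temkin2013Relative` = Temkin 2013, arXiv:0804.1554v3, Thm. 1.3.2, corrected relative form):
local uniformization of `α_p`-torsors over regular bases over perfect ground fields implies
relative local uniformization over every perfect ground field of characteristic `p`. Proof: the
pushed chart of `stub_perfectChartOfTemkin` completed by `stub_perfectTowerClimb` (Temkin 2013,
Rem. 1.3.5 (i)–(ii) at `[k : k^p] = 1`). -/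
theorem torsorToLurelPerfect_of_temkin2013Relative (hTem : Temkin2013Relative.{0}) :
    Theses.ShadowGame.TorsorToLurelPerfect := by
  intro p hp hT k K _ _ _ _ _ hfg O hO R hRfg hRO
  exact stub_perfectTowerClimb p hp hT k K hfg O hO R hRfg hRO
    (stub_perfectChartOfTemkin hTem p hp k K hfg O hO R hRfg hRO)

/-- **The crux modulo the single remaining leaf** `Temkin2013RelativeCurveSmoothFibre` (Temkin
2013, Thm. 3.3.1 for `k`-smooth generic fibres — Berkovich stable modification, Krasner,
algebraization) of the tree's proof cone of Temkin's theorem, via the in-tree one-line reduction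
`Temkin2013Relative.of_smoothFibre`. CONDITIONAL. -/
theorem torsorToLurelPerfect_of_smoothFibre (hsf : Temkin2013RelativeCurveSmoothFibre.{0}) :
    Theses.ShadowGame.TorsorToLurelPerfect :=
  torsorToLurelPerfect_of_temkin2013Relative (Temkin2013Relative.of_smoothFibre hsf)

/-- The CONDITIONAL crux for the payload route's decl (FrobeniusClosing), from
`Temkin2013Relative`. -/
theorem torsorToLurelPerfect_frobeniusClosing_of_temkin2013Relative (hTem : Temkin2013Relative.{0}) :
    Theses.FrobeniusClosing.TorsorToLurelPerfect :=
  torsorToLurelPerfect_frobeniusClosing_iff_shadowGame.mpr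
    (torsorToLurelPerfect_of_temkin2013Relative hTem)

/-- The CONDITIONAL crux for the payload route's decl (FrobeniusClosing), from the leaf
`Temkin2013RelativeCurveSmoothFibre`. -/
theorem torsorToLurelPerfect_frobeniusClosing_of_smoothFibre
    (hsf : Temkin2013RelativeCurveSmoothFibre.{0}) :
    Theses.FrobeniusClosing.TorsorToLurelPerfect :=
  torsorToLurelPerfect_frobeniusClosing_iff_shadowGame.mpr (torsorToLurelPerfect_of_smoothFibre hsf)

/-- **What the crux needs from Temkin, exactly — pushed charts suffice (UNCONDITIONAL).** If for
the prime `p` every datum `(k, K, O, R)` over a perfect `k` of characteristic `p` (`K/k` finitely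
generated, `O ⊇ k` a valuation ring of `K`, `R ⊆ O` finitely generated) admits a Frobenius-pushed
chart — `m` and a finitely generated `k`-subalgebra `A₀ ⊆ O`, regular at the centre, with
`R ^ {p^m} ⊆ A₀` and `K ^ {p^m} ⊆ k(A₀)` (the strategist's split child `PerfectFrobeniusChart`
at `p`; Temkin 2013, Rem. 1.3.5 (i), conclusion only) — then the crux's implication holds at `p`:
the perfect torsor hypothesis completes every pushed chart (`stub_perfectTowerClimb`). So the
residual content of `TorsorToLurelPerfect` is the existence of pushed charts over perfect fields,
i.e. Temkin's Thm. 1.3.2 over perfect ground fields read through Frobenius. [folklore] -/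
theorem torsorToLurelPerfect_at_of_pushedCharts (p : ℕ) (hp : p.Prime)
    (hchart : ∀ (k K : Type) [Field k] [CharP k p] [PerfectField k] [Field K] [Algebra k K],
      (⊤ : IntermediateField k K).FG → ∀ O : ValuationSubring K, (∀ c : k, algebraMap k K c ∈ O) →
      ∀ R : Subalgebra k K, R.FG → R.toSubring ≤ O.toSubring →
      ∃ (m : ℕ) (A₀ : Subalgebra k K) (h₀ : A₀.toSubring ≤ O.toSubring), A₀.FG ∧
        (∀ r ∈ R, r ^ p ^ m ∈ A₀) ∧
        (∀ x : K, x ^ p ^ m ∈ IntermediateField.adjoin k (A₀ : Set K)) ∧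
        IsRegularLocalRing (Localization.AtPrime
          (Ideal.comap (Subring.inclusion h₀) (maximalIdeal O))))
    (hT : ∀ (k K : Type) [Field k] [CharP k p] [PerfectField k] [Field K] [Algebra k K]
      (O : ValuationSubring K) (A₀ : Subalgebra k K) (h₀ : A₀.toSubring ≤ O.toSubring) (t : K),
      A₀.FG → t ^ p ∈ A₀ → IsFractionRing (Algebra.adjoin k (insert t (A₀ : Set K))) K →
      IsRegularLocalRing (Localization.AtPrime
        (Ideal.comap (Subring.inclusion h₀) (maximalIdeal O))) →
      ∃ (A : Subalgebra k K) (h : A.toSubring ≤ O.toSubring), A₀ ≤ A ∧ t ∈ A ∧ A.FG ∧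
        IsFractionRing A K ∧
        IsRegularLocalRing (Localization.AtPrime
          (Ideal.comap (Subring.inclusion h) (maximalIdeal O))))
    (k K : Type) [Field k] [CharP k p] [PerfectField k] [Field K] [Algebra k K]
    (hfg : (⊤ : IntermediateField k K).FG) (O : ValuationSubring K)
    (hO : ∀ c : k, algebraMap k K c ∈ O) (R : Subalgebra k K) (hRfg : R.FG)
    (hRO : R.toSubring ≤ O.toSubring) :
    ∃ (A : Subalgebra k K) (h : A.toSubring ≤ O.toSubring), R ≤ A ∧ A.FG ∧ IsFractionRing A K ∧
      IsRegularLocalRing (Localization.AtPrime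
        (Ideal.comap (Subring.inclusion h) (maximalIdeal O))) :=
  stub_perfectTowerClimb p hp hT k K hfg O hO R hRfg hRO (hchart k K hfg O hO R hRfg hRO)

/-- **The split glue with its second child discharged (UNCONDITIONAL)**: pushed charts over all
perfect fields of every prime characteristic (the split child `PerfectFrobeniusChart` of
STRATEGY-CENSUS.md, verbatim) imply the crux — `PerfectTowerClimb` being the landed
`stub_perfectTowerClimb`. [folklore] -/
theorem torsorToLurelPerfect_of_perfectFrobeniusChart
    (hchart : ∀ p : ℕ, p.Prime → ∀ (k K : Type) [Field k] [CharP k p] [PerfectField k] [Field K]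
      [Algebra k K], (⊤ : IntermediateField k K).FG → ∀ O : ValuationSubring K,
      (∀ c : k, algebraMap k K c ∈ O) → ∀ R : Subalgebra k K, R.FG → R.toSubring ≤ O.toSubring →
      ∃ (m : ℕ) (A₀ : Subalgebra k K) (h₀ : A₀.toSubring ≤ O.toSubring), A₀.FG ∧
        (∀ r ∈ R, r ^ p ^ m ∈ A₀) ∧
        (∀ x : K, x ^ p ^ m ∈ IntermediateField.adjoin k (A₀ : Set K)) ∧
        IsRegularLocalRing (Localization.AtPrime
          (Ideal.comap (Subring.inclusion h₀) (maximalIdeal O)))) :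
    Theses.ShadowGame.TorsorToLurelPerfect :=
  fun p hp hT k K _ _ _ _ _ hfg O hO R hRfg hRO =>
    torsorToLurelPerfect_at_of_pushedCharts p hp (hchart p hp) hT k K hfg O hO R hRfg hRO

end Summit.ResolutionOfSingularities.ResolutionOfSingularities.Theorems

end
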